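import Summits.NavierStokesRegularity.FluidComputer.GateBudgetSecondMisfire
import HarnessLib

/-!
# What no tuning can beat, part 47: THE THIRD IGNITION OF A LATTICE DUD — the re-arming laws
# at a LATE dousing (from any `T ≤ 5` with `-1.4401ε ≤ b(T) ≤ 0`, `c(T) ≤ 2ρ²/K¹⁰`,
# `d² + ã² ≤ 1/60` the clock crosses zero before `T + 3/2` at rate `≥ 0.983ε`; from any zero
# `S ≤ 8` with `c(S) ≤ 3ρ²/K¹⁰`, `d² + ã² ≤ 1/60 + 4/K¹⁰` the trigger is back at `ρ²/K⁹` within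
# `1.43`), fed with part 46's master tuple: `c(r₂) = ρ²/K⁹`, `T₂ + 2.7878 < r₂ < T₂ + 2.93`,
# `1.265ε ≤ b(r₂) ≤ 1.43ε`, `a(r₂)² ≥ 0.983`

Cell `pub-fluidc`, blueprint seat bp1 (gen 33, seventh item); same namespace and conventions as
parts 1–46 (`GateBudget*.lean`); imports part 46 (`GateBudgetSecondMisfire`, and through it part
36 `GateBudgetRearm`: `dud_clock_rearms`, `dud_refires`, and part 37 `GateBudgetDudRefire`:
`refire_window_facts`). Headline amplifier `M = K¹⁰` (`μ = ε⁻¹K¹⁰`, `σ = ρ²e^{-K¹⁰}`,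
`R = ρ⁻²`), `K ≥ 16`, `ε² ≤ 1/(6K²⁰)`, `K¹⁰ρ² ≤ 2ε`; `q = K⁻¹⁰`, `p = K⁻⁹`. Modes `0 = a`,
`1 = b` clock, `2 = c` trigger, `3 = d`, `4 = ã` of `rotorCircuit K K¹⁰ ε ρ` from (5.6).
HONEST FRAMING (verbatim): low prior, high value-of-information experiment on Tao's machine
paradigm; NOT a claim that NS blows up. Nothing is proved about the Navier–Stokes equations.

THE POINT (SPEC-INPUT-bp1 §AS item (19b⁗) FILE 2). Part 37 put the numbers of the FIRST
re-arming into part 36's two continuity arguments — but from a dousing at `T ≤ 1.4144` with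
`d² + ã² ≤ 0.0069` and a zero of the clock at `S ≤ 7/2`. The second dousing of a lattice
dud happens at `T₂ ≈ 4.27` with `d(T₂)² + ã(T₂)² ≤ 1/60` (part 46), so part 37's two theorems do
not apply; this part re-instantiates part 36 with the LATE numbers, generically in the time:
* §138 `late_clock_small`: `b(t)² ≤ K⁻¹⁰` for `0 ≤ t ≤ 10` (`|b| ≤ (ε + σ)t ≤ 21ε`).
* §139 `knob_late_rearm_clock` — PHASE 1 from ANY `T ∈ [0, 5]` with `-1.4401ε ≤ b(T) ≤ 0`,
  `c(T) ≤ 2ρ²/K¹⁰`, `d(T)² + ã(T)² ≤ 1/60`: part 36's `dud_clock_rearms` with `H = 3/2`,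
  `β = 1.4401ε`, `ν = q`, `c₀ = 2qρ²`, `θ = 1/60`: the level `c₁ = c₀ + σH ≤ 3qρ²`, the dose
  `R(c₀H + σH²/2) ≤ 4q`, the rate `κ ≥ ε(59/60 - 9q) - … ≥ 0.983ε + εq`, the budget
  `1.4401ε < (3/2)·0.983ε = 1.4745ε`; OUTPUT: a zero `tz < T + 3/2` of the clock with
  `ε(tz - T) ≥ -b(T)`, and on `[T, tz]`: `b ≤ 0`, `c ≤ 3ρ²/K¹⁰`, `b(t) ≥ b(T) + 0.983ε(t - T)`,
  `a² ≥ 49/50`, `d² + ã² ≤ 1/60 + 4/K¹⁰`.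
* §140 `knob_late_relight` — PHASE 2 from ANY zero `S ∈ [0, 8]` of the clock with
  `c(S) ≤ 3ρ²/K¹⁰`, `d(S)² + ã(S)² ≤ 1/60 + 4/K¹⁰`: part 36's `dud_refires` with `γ = pρ²`,
  `Δ = 1.43`, `δ = 10⁻²`, `ν = q`: `α ≥ 0.983 + q`, `κ' = εα - μγ² ≥ 0.983ε`, LOOP GAIN
  `e^{-K¹⁰}e^{κ'μ(Δ² - δ²)/2} ≥ e^{(0.983·1.0224 - 1)K¹⁰} ≥ 0.005K¹⁰` (part 37: `0.0152K¹⁰`;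
  with part 42's `θ = 1/40` the exponent `0.975·1.0224 - 1` would be NEGATIVE), budget
  `p < 0.983·10⁻²·0.005K¹⁰`; OUTPUT: `r ∈ (S, S + 1.43)` with `c(r) = ρ²/K⁹`, and on `[S, r]`:
  `c ≤ ρ²/K⁹`, `b(t) ≥ 0.983ε(t - S)`, `a² ≥ 0.983`.
* §141 `knob_dud_third_ignition` — part 46's master tuple `T, tz, r₁, T₂` (lattice dud,
  `0 ≤ T₂ ≤ 5` from the brackets) into §139 (`tz₂ ≥ T₂ + 1.3939` from `b(T₂) ≤ -1.3939ε`), its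
  zero `tz₂ ≤ 6.5` into §140, and part 45's COLD WINDOW (`c < ρ²/K⁹` on `[T₂, T₂ + 2.7878]`)
  forbids `c(r₂) = ρ²/K⁹` there: `r₂ > T₂ + 2.7878`, so `r₂ - tz₂ > 1.2878` and
  `b(r₂) ≥ 0.983·1.2878ε ≥ 1.265ε`; `b(r₂) ≤ ε(r₂ - tz₂) < 1.43ε` (part 5's `clock_recovery`).

READING. The two continuity arguments of part 36 run at any late time with the same shape of
numbers: the only inputs that moved are the output pair (`1/60` for `0.0069`) — it costs one
percent of the pump rate (`0.983ε` for `0.993ε`) and two thirds of the loop-gain exponent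
(`0.005K¹⁰` for `0.0152K¹⁰`, still astronomically more than the `log K¹⁹` needed) — and the
horizon (`T ≤ 5`, `S ≤ 8`: the clock is a priori `≤ 21ε`, still `b² ≤ K⁻¹⁰`). THE INDUCTION
OVER PULSES HAS STARTED: pulse `3` ignites `≈ 2.8`–`2.93` after the second dousing with the clock
in `[1.265ε, 1.43ε]` (pulse `2`: `[1.394ε, 1.44ε]`) and `≥ 98.3 %` of the energy in the carrier;
its window, dousing and misfire are part 18 / part 39 / part 42 again (successor, item (19b⁵):
the pair budget `1/60 + 0.0049 + …` per pulse is what limits the number of pulses).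
HONEST LIMITS. (i) Fixed constants: entry clock `≥ -1.4401ε`, pair `≤ 1/60`, horizons `5`
and `8` — enough for the third cycle (and, clock-wise, for any later one), NOT for a pair
beyond `1/60` (pulse `4` onwards needs the per-pulse leak controlled, successor item (19b⁵));
(ii) §140 bounds the re-light time from above only; the lower bound `r₂ > T₂ + 2.7878` is part
45's cold window, so `r₂` is located to `±0.08` only (pulse `2`: `±0.013`); (iii) `M = K¹⁰`,
`K ≥ 16`, `K¹⁰ρ² ≤ 2ε`, `ε² ≤ 1/(6K²⁰)`; §138–§140 carry no lattice condition (laws of the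
trajectory from a state), §141 is about lattice duds `ε = k·K¹⁰ρ²`, `200ε/K²⁰ ≤ ρ²`;
(iv) nothing about Navier–Stokes.
[cite: Tao2016AveragedNS, §5.5 Theorem 5.3, (5.5), (5.6), (b-eq), (c-eq), (energy-con)]
-/

noncomputable section

namespace Summit.NavierStokesRegularity.FluidComputer.GateBudget

open Real Set Filter Topology
open Literature.Analysis.FluidPDE.Tao2016AveragedNS

variable {K ε ρ : ℝ} {X : ℝ → Fin 5 → ℝ} {C : ℝ → ℝ}

/-! ## §138 The clock is a priori small up to time `10` -/

/-- THE CLOCK IS A PRIORI SMALL, LATE: `b(t)² ≤ K⁻¹⁰` for `0 ≤ t ≤ 10` (`|b(t)| ≤ (ε + σ)t ≤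
21ε`, part 1's `abs_b_le`, and `441ε² ≤ 74K⁻²⁰ ≤ K⁻¹⁰`). [cite: Tao2016AveragedNS, §5.5 (b-eq)] -/
theorem late_clock_small
    (hX : ∀ t, HasDerivAt X (RotorKnob.rotorCircuit K (K ^ 10) ε ρ (X t)) t)
    (h0 : X 0 = delayInit) (hK : 16 ≤ K) (hε : 0 < ε) (hεK : ε ^ 2 ≤ 1 / (6 * K ^ 20))
    (hρ : 0 < ρ) (hhi : K ^ 10 * ρ ^ 2 ≤ 2 * ε) {r : ℝ} (hr : 0 ≤ r) (hr10 : r ≤ 10) :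
    X r 1 ^ 2 ≤ 1 / K ^ 10 := by
  have hK0 : 0 < K := by linarith
  obtain ⟨hq1, hq2, -, -, -, -, -, -, -, -, hσq, hε2, -⟩ := refire_window_facts hK hε hεK hhi
  have hq0 : 0 < 1 / K ^ 10 := by positivity
  have hXf := hX
  rw [RotorKnob.rotorCircuit_eq_fiveGate] at hXf
  have hb := abs_b_le hXf h0 hε.le (by positivity) hr
  have h1 : (ε + ρ ^ 2 * exp (-K ^ 10)) * r ≤ 21 * ε := by
    have h2 : ρ ^ 2 * exp (-K ^ 10) ≤ ε := hσq.trans (by nlinarith only [hq1, hε])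
    nlinarith only [h2, hr, hr10, hε, (exp_pos (-K ^ 10)).le, sq_nonneg ρ]
  have h3 : X r 1 ^ 2 ≤ (21 * ε) ^ 2 := by
    rw [← sq_abs]; exact pow_le_pow_left₀ (abs_nonneg _) (hb.trans h1) 2
  linarith only [h3, hε2, hq2, hq0]

/-! ## §139 Phase 1 at a late dousing: the clock re-arms before `T + 3/2` -/

/-- **PHASE 1, LATE — THE CLOCK RE-ARMS** (`M = K¹⁰`, `K ≥ 16`, `K¹⁰ρ² ≤ 2ε`): from ANY time
`T ∈ [0, 5]` with `-1.4401ε ≤ b(T) ≤ 0`, `c(T) ≤ 2ρ²/K¹⁰`, `d(T)² + ã(T)² ≤ 1/60` the clock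
crosses zero at some `tz < T + 3/2` with `ε(tz - T) ≥ -b(T)`, and on `[T, tz]`: `b ≤ 0`,
`c ≤ 3ρ²/K¹⁰`, `b(t) ≥ b(T) + 0.983ε(t - T)`, `a² ≥ 49/50`, `d² + ã² ≤ 1/60 + 4/K¹⁰` (part 36's
`dud_clock_rearms`, `H = 3/2`, `β = 1.4401ε`; budget `1.4401 < 1.4745`).
[cite: Tao2016AveragedNS, §5.5 Theorem 5.3, (b-eq), (c-eq), (energy-con)] -/
theorem knob_late_rearm_clock
    (hX : ∀ t, HasDerivAt X (RotorKnob.rotorCircuit K (K ^ 10) ε ρ (X t)) t)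
    (h0 : X 0 = delayInit) (hK : 16 ≤ K) (hε : 0 < ε) (hεK : ε ^ 2 ≤ 1 / (6 * K ^ 20))
    (hρ : 0 < ρ) (hhi : K ^ 10 * ρ ^ 2 ≤ 2 * ε) {T : ℝ} (hT : 0 ≤ T) (hT5 : T ≤ 5)
    (hbT : X T 1 ≤ 0) (hβ : -(14401 / 10000 * ε) ≤ X T 1) (hcT : X T 2 ≤ 2 * ρ ^ 2 / K ^ 10)
    (hθ : X T 3 ^ 2 + X T 4 ^ 2 ≤ 1 / 60) :
    ∃ tz, T ≤ tz ∧ tz < T + 3 / 2 ∧ -X T 1 ≤ ε * (tz - T) ∧ X tz 1 = 0 ∧ ∀ r ∈ Icc T tz,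
      X r 1 ≤ 0 ∧ X r 2 ≤ 3 * ρ ^ 2 / K ^ 10 ∧ X T 1 + 983 / 1000 * ε * (r - T) ≤ X r 1 ∧
      49 / 50 ≤ X r 0 ^ 2 ∧ X r 3 ^ 2 + X r 4 ^ 2 ≤ 1 / 60 + 4 / K ^ 10 := by
  have hK0 : 0 < K := by linarith
  obtain ⟨hq1, hq2, hq3, he2, -, hρq, -, -, hρ1, h16, -, -, -, -, -⟩ :=
    refire_window_facts hK hε hεK hhi
  rw [show 2 * ρ ^ 2 / K ^ 10 = 2 * (1 / K ^ 10) * ρ ^ 2 by ring] at hcT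
  rw [show (4 : ℝ) / K ^ 10 = 4 * (1 / K ^ 10) by ring,
    show 3 * ρ ^ 2 / K ^ 10 = 3 * (1 / K ^ 10) * ρ ^ 2 by ring]
  set q : ℝ := 1 / K ^ 10 with hq
  have hq0 : 0 < q := by positivity
  have he0 : 0 ≤ exp (-K ^ 10) := (exp_pos _).le
  have hXf := hX
  rw [RotorKnob.rotorCircuit_eq_fiveGate] at hXf
  have hσ0 : 0 ≤ ρ ^ 2 * exp (-K ^ 10) := by positivity
  have hμ0 : 0 ≤ ε⁻¹ * K ^ 10 := by positivity
  have hν : ∀ r ∈ Icc T (T + 3 / 2), X r 1 ^ 2 ≤ q := fun r hr =>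
    late_clock_small hX h0 hK hε hεK hρ hhi (hT.trans hr.1) (by linarith only [hr.2, hT5])
  -- the level `c₁ = 2q + (3/2)e ≤ 3q` and the dose `3q + (9/8)e ≤ 4q`
  have hl1 : 2 * q + exp (-K ^ 10) * (3 / 2) ≤ 3 * q := by
    linarith only [he2, hq2, hq0]
  have hdose : 2 * q * (3 / 2) + exp (-K ^ 10) * (3 / 2) ^ 2 / 2 ≤ 4 * q := by
    linarith only [he2, hq2, hq0]
  have hcσ : 2 * q * ρ ^ 2 + ρ ^ 2 * exp (-K ^ 10) * (3 / 2)
      = (2 * q + exp (-K ^ 10) * (3 / 2)) * ρ ^ 2 := by ring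
  have hc1 : ((2 * q + exp (-K ^ 10) * (3 / 2)) * ρ ^ 2) ^ 2 ≤ 36 * ε ^ 2 * q ^ 4 := by
    have h1 : (2 * q + exp (-K ^ 10) * (3 / 2)) * ρ ^ 2 ≤ 6 * ε * q ^ 2 :=
      calc _ ≤ 3 * q * (2 * ε * q) := mul_le_mul hl1 hρq (sq_nonneg ρ) (by positivity)
        _ = 6 * ε * q ^ 2 := by ring
    calc _ ≤ (6 * ε * q ^ 2) ^ 2 := pow_le_pow_left₀ (by positivity) h1 2
      _ = 36 * ε ^ 2 * q ^ 4 := by ring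
  have hRd : (ρ ^ 2)⁻¹ * (2 * q * ρ ^ 2 * (3 / 2) + ρ ^ 2 * exp (-K ^ 10) * (3 / 2) ^ 2 / 2)
      = 2 * q * (3 / 2) + exp (-K ^ 10) * (3 / 2) ^ 2 / 2 := by
    field_simp
  -- the rate `κ ≥ 0.983ε + εq`
  have hn2 : (983 : ℝ) / 1000 + 10 * q ≤ 1 - 1 / 60 := by linarith only [hq1]
  have hκ : 983 / 1000 * ε + ε * q
      ≤ ε * (1 - q - ((2 * q + exp (-K ^ 10) * (3 / 2)) * ρ ^ 2) ^ 2 - 1 / 60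
          - (2 * q * (3 / 2) + exp (-K ^ 10) * (3 / 2) ^ 2 / 2))
        - ε⁻¹ * K ^ 10 * ((2 * q + exp (-K ^ 10) * (3 / 2)) * ρ ^ 2) ^ 2 := by
    have hS1 : ε * ((2 * q + exp (-K ^ 10) * (3 / 2)) * ρ ^ 2) ^ 2 ≤ 9 / 4 * (ε * q) := by
      have h1 := mul_le_mul_of_nonneg_left hc1 hε.le
      have h2 := mul_le_mul_of_nonneg_left h16 hε.le
      nlinarith only [h1, h2]
    have hS3 : ε⁻¹ * K ^ 10 * ((2 * q + exp (-K ^ 10) * (3 / 2)) * ρ ^ 2) ^ 2 ≤ ε * q := by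
      have h1 := mul_le_mul_of_nonneg_left hc1 hμ0
      rw [show ε⁻¹ * K ^ 10 * (36 * ε ^ 2 * q ^ 4) = 36 * ε * q ^ 3 by rw [hq]; field_simp] at h1
      nlinarith only [h1, mul_le_mul_of_nonneg_left hq3 hε.le, mul_pos hε hq0]
    nlinarith only [hS1, mul_le_mul_of_nonneg_left hdose hε.le, hS3,
      mul_le_mul_of_nonneg_left hn2 hε.le, mul_pos hε hq0]
  -- part 36 with the budget `1.4401ε < (3/2)(0.983ε + εq)`
  obtain ⟨tz, htzm, htzH, hbz, hP, hcz, hoz, hclz, hzlow⟩ :=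
    dud_clock_rearms hXf h0 hε.le hσ0 hμ0 (by positivity) hT hbT hβ hcT hθ hν (by norm_num) (by
        rw [hRd, hcσ]
        nlinarith only [hκ, hε, mul_pos hε hq0])
  have hH : ∀ r ∈ Icc T tz, 0 ≤ r - T ∧ r - T ≤ 3 / 2 := fun r hr =>
    ⟨by linarith only [hr.1], by linarith only [hr.2, htzm.2]⟩
  -- the trigger and the output pair on `[T, tz]`
  have hcz' : ∀ r ∈ Icc T tz, X r 2 ≤ 3 * q * ρ ^ 2 := fun r hr => by
    have h2 : ρ ^ 2 * exp (-K ^ 10) * (r - T) ≤ ρ ^ 2 * exp (-K ^ 10) * (3 / 2) :=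
      mul_le_mul_of_nonneg_left (hH r hr).2 hσ0
    nlinarith only [hcz r hr, h2, mul_le_mul_of_nonneg_right hl1 (sq_nonneg ρ)]
  have hoz' : ∀ r ∈ Icc T tz, X r 3 ^ 2 + X r 4 ^ 2 ≤ 1 / 60 + 4 * q := fun r hr => by
    have h1 := hoz r hr
    rw [show (ρ ^ 2)⁻¹ * (2 * q * ρ ^ 2 * (r - T) + ρ ^ 2 * exp (-K ^ 10) * (r - T) ^ 2 / 2)
        = 2 * q * (r - T) + exp (-K ^ 10) * (r - T) ^ 2 / 2 by field_simp] at h1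
    have h3 : 2 * q * (r - T) ≤ 2 * q * (3 / 2) :=
      mul_le_mul_of_nonneg_left (hH r hr).2 (by positivity)
    have h5 := mul_le_mul_of_nonneg_left (pow_le_pow_left₀ (hH r hr).1 (hH r hr).2 2) he0
    nlinarith only [h1, h3, h5, hdose]
  refine ⟨tz, htzm.1, htzH, hzlow, hbz, fun r hr => ⟨hP r hr, hcz' r hr, ?_, ?_, hoz' r hr⟩⟩
  · have h1 := hclz r hr
    rw [hRd, hcσ] at h1
    nlinarith only [h1, mul_le_mul_of_nonneg_right hκ (hH r hr).1,
      mul_nonneg (mul_nonneg hε.le hq0.le) (hH r hr).1]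
  · have hb2 : X r 1 ^ 2 ≤ q := hν r ⟨hr.1, by linarith only [hr.2, htzH]⟩
    have hc2 : X r 2 ^ 2 ≤ (3 * q * ρ ^ 2) ^ 2 :=
      pow_le_pow_left₀ (RotorKnob.c_nonneg hX h0 (hT.trans hr.1)) (hcz' r hr) 2
    have hρ4 : (ρ ^ 2) ^ 2 ≤ 1 := pow_le_one₀ (sq_nonneg ρ) hρ1
    have hc3 := mul_le_mul_of_nonneg_left hρ4 (by positivity : (0 : ℝ) ≤ 9 * q ^ 2)
    nlinarith only [RotorKnob.traj_sum_sq_eq_one hX h0 r, hb2, hc2, hc3, hoz' r hr, hn2, hq2,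
      hq0]

/-! ## §140 Phase 2 from a late zero of the clock: the trigger relights within `1.43` -/

/-- **PHASE 2, LATE — THE TRIGGER RELIGHTS** (`M = K¹⁰`, `K ≥ 16`, `K¹⁰ρ² ≤ 2ε`): from ANY
`S ∈ [0, 8]` with `b(S) = 0`, `c(S) ≤ 3ρ²/K¹⁰`, `d(S)² + ã(S)² ≤ 1/60 + 4/K¹⁰`, the trigger is
back at `ρ²/K⁹` at some `r ∈ (S, S + 1.43)`, and on `[S, r]`: `c ≤ ρ²/K⁹`, `b(t) ≥ 0.983ε(t - S)`,
`a² ≥ 0.983` (part 36's `dud_refires`, `γ = ρ²/K⁹`, `Δ = 1.43`, `δ = 10⁻²`; loop gain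
`e^{(0.983·1.0224 - 1)K¹⁰} ≥ 0.005K¹⁰`). [cite: Tao2016AveragedNS, §5.5 Theorem 5.3, (c-eq)] -/
theorem knob_late_relight
    (hX : ∀ t, HasDerivAt X (RotorKnob.rotorCircuit K (K ^ 10) ε ρ (X t)) t)
    (h0 : X 0 = delayInit) (hK : 16 ≤ K) (hε : 0 < ε) (hεK : ε ^ 2 ≤ 1 / (6 * K ^ 20))
    (hρ : 0 < ρ) (hhi : K ^ 10 * ρ ^ 2 ≤ 2 * ε) {S : ℝ} (hS : 0 ≤ S) (hS8 : S ≤ 8)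
    (hbS : X S 1 = 0) (hcS : X S 2 ≤ 3 * ρ ^ 2 / K ^ 10)
    (hoS : X S 3 ^ 2 + X S 4 ^ 2 ≤ 1 / 60 + 4 / K ^ 10) :
    ∃ r₁, S < r₁ ∧ r₁ < S + 143 / 100 ∧ X r₁ 2 = ρ ^ 2 / K ^ 9 ∧ ∀ r ∈ Icc S r₁,
      X r 2 ≤ ρ ^ 2 / K ^ 9 ∧ 983 / 1000 * ε * (r - S) ≤ X r 1 ∧ 983 / 1000 ≤ X r 0 ^ 2 := by
  have hK0 : 0 < K := by linarith
  have hK9 : 0 < K ^ 9 := by positivity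
  have hK10 : 0 < K ^ 10 := by positivity
  obtain ⟨hq1, -, -, -, -, hρq, -, -, hρ1, -, -, -, hp1, -, -⟩ :=
    refire_window_facts hK hε hεK hhi
  have h10 : (1099511627776 : ℝ) ≤ K ^ 10 := by
    have := headline_pow_floor hK 10; norm_num at this; exact this
  rw [show (4 : ℝ) / K ^ 10 = 4 * (1 / K ^ 10) by ring] at hoS
  rw [show 3 * ρ ^ 2 / K ^ 10 = 3 * (1 / K ^ 10) * ρ ^ 2 by ring] at hcS
  rw [show ρ ^ 2 / K ^ 9 = 1 / K ^ 9 * ρ ^ 2 by ring]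
  set q : ℝ := 1 / K ^ 10 with hq
  set p : ℝ := 1 / K ^ 9 with hp
  have hq0 : 0 < q := by positivity
  have hp0 : 0 < p := by positivity
  have hqp : 3 * q < p := by
    rw [hq, hp, show 3 * (1 / K ^ 10) = 3 / K ^ 10 by ring, div_lt_div_iff₀ hK10 hK9]
    nlinarith only [hK, hK9, show K ^ 10 = K * K ^ 9 by ring]
  have hXf := hX
  rw [RotorKnob.rotorCircuit_eq_fiveGate] at hXf
  have hμ0 : 0 ≤ ε⁻¹ * K ^ 10 := by positivity
  have hρ2 : 0 < ρ ^ 2 := by positivity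
  have hqρ : 3 * q * ρ ^ 2 < p * ρ ^ 2 := mul_lt_mul_of_pos_right hqp hρ2
  have hν : ∀ r ∈ Icc S (S + 143 / 100), X r 1 ^ 2 ≤ q := fun r hr =>
    late_clock_small hX h0 hK hε hεK hρ hhi (hS.trans hr.1) (by linarith only [hr.2, hS8])
  have hRγ : (ρ ^ 2)⁻¹ * (p * ρ ^ 2 * (143 / 100)) = 143 / 100 * p := by field_simp
  have hγ2 : (p * ρ ^ 2) ^ 2 ≤ p := by
    have hρ4 : (ρ ^ 2) ^ 2 ≤ 1 := pow_le_one₀ hρ2.le hρ1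
    nlinarith only [mul_le_mul_of_nonneg_left hρ4 (sq_nonneg p), hp1, hp0]
  have hμγ : ε⁻¹ * K ^ 10 * (p * ρ ^ 2) ^ 2 ≤ ε * q := by
    have h2 := mul_le_mul_of_nonneg_left
      (mul_le_mul_of_nonneg_left hρq (by positivity : 0 ≤ p ^ 2 * ρ ^ 2)) hμ0
    rw [show ε⁻¹ * K ^ 10 * (p ^ 2 * ρ ^ 2 * (2 * ε * q)) = 2 * p ^ 2 * ρ ^ 2 by
      rw [hq]; field_simp] at h2
    have h4 := mul_le_mul_of_nonneg_left hρq (by positivity : 0 ≤ 2 * p ^ 2)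
    have h6 := mul_le_mul_of_nonneg_right (by nlinarith only [hp1, hp0] : p ^ 2 ≤ 1 / 4)
      (by positivity : 0 ≤ 4 * ε * q)
    nlinarith only [h2, h4, h6]
  set α := 1 - q - (p * ρ ^ 2) ^ 2 - (1 / 60 + 4 * q)
    - (ρ ^ 2)⁻¹ * (p * ρ ^ 2 * (143 / 100)) with hα
  have hn2 : (983 : ℝ) / 1000 + 6 * q + 3 * p ≤ 1 - 1 / 60 := by linarith only [hq1, hp1]
  have hα1 : 983 / 1000 + q ≤ α := by
    rw [hα, hRγ]; linarith only [hn2, hγ2, hp0, hq0]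
  have hα0 : 983 / 1000 ≤ α := by linarith only [hα1, hq0]
  set κ := ε * α - ε⁻¹ * K ^ 10 * (p * ρ ^ 2) ^ 2 with hκ
  have hκ1 : 983 / 1000 * ε ≤ κ := by
    rw [hκ]; nlinarith only [mul_le_mul_of_nonneg_left hα1 hε.le, hμγ]
  -- the loop gain `e^{-K¹⁰}·e^{κμ(Δ² - δ²)/2} ≥ 0.005K¹⁰`
  have hE : 50 / 10000 * K ^ 10
      ≤ exp (-K ^ 10) * exp (κ * (ε⁻¹ * K ^ 10) * ((143 / 100) ^ 2 - (1 / 100) ^ 2) / 2) := by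
    have h2 := mul_le_mul_of_nonneg_right hκ1 hμ0
    rw [show 983 / 1000 * ε * (ε⁻¹ * K ^ 10) = 983 / 1000 * K ^ 10 by field_simp] at h2
    rw [← exp_add]
    nlinarith only [h2, hK10,
      add_one_le_exp (-K ^ 10 + κ * (ε⁻¹ * K ^ 10) * ((143 / 100) ^ 2 - (1 / 100) ^ 2) / 2)]
  -- the budget `γ = pρ² < 0.983·10⁻²·0.005K¹⁰ρ² ≤ σαδ·e^{κμ(Δ² - δ²)/2}`, and part 36
  have hn3 : p < 983 / 1000 * (1 / 100) * (50 / 10000 * K ^ 10) := by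
    linarith only [hp1, h10]
  have hbud : p * ρ ^ 2 < ρ ^ 2 * exp (-K ^ 10) * α * (1 / 100)
      * exp (κ * (ε⁻¹ * K ^ 10) * ((143 / 100) ^ 2 - (1 / 100) ^ 2) / 2) := by
    have h2 := mul_le_mul_of_nonneg_left (mul_le_mul hα0 hE (by positivity) (by linarith))
      (by positivity : (0 : ℝ) ≤ ρ ^ 2 * (1 / 100))
    calc p * ρ ^ 2 = ρ ^ 2 * p := mul_comm _ _
      _ < ρ ^ 2 * (983 / 1000 * (1 / 100) * (50 / 10000 * K ^ 10)) :=
          mul_lt_mul_of_pos_left hn3 hρ2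
      _ = ρ ^ 2 * (1 / 100) * (983 / 1000 * (50 / 10000 * K ^ 10)) := by ring
      _ ≤ ρ ^ 2 * (1 / 100) * (α * (exp (-K ^ 10)
          * exp (κ * (ε⁻¹ * K ^ 10) * ((143 / 100) ^ 2 - (1 / 100) ^ 2) / 2))) := h2
      _ = _ := by ring
  have hκ0 : 0 ≤ κ := by linarith only [hκ1, hε]
  obtain ⟨r₁, hr₁m, hr₁Δ, hcr₁, hQ, -, hcl, ha⟩ :=
    dud_refires (δ := 1 / 100) hXf h0 hε.le (by positivity) hμ0 (by positivity) hS hbS.ge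
      (hcS.trans hqρ.le) hoS hν (by norm_num) (by norm_num) hκ0 hbud
  have hS1 : S < r₁ := by
    rcases lt_or_eq_of_le hr₁m.1 with h | h
    · exact h
    · exfalso; rw [← h] at hcr₁; linarith only [hcr₁, hcS, hqρ]
  refine ⟨r₁, hS1, hr₁Δ, hcr₁, fun r hr => ⟨hQ r hr, ?_, hα0.trans (ha r hr)⟩⟩
  have h1 := hcl r hr
  rw [hbS, zero_add] at h1
  exact (mul_le_mul_of_nonneg_right hκ1 (by linarith only [hr.1])).trans h1

/-! ## §141 The third ignition of a lattice dud -/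

/-- **THE THIRD IGNITION OF A LATTICE DUD** (`M = K¹⁰`, `K ≥ 16`, window member, `ε² ≤ 1/(6K²⁰)`,
`ε = k·K¹⁰ρ²`). Part 46's master tuple `T, tz, r₁, T₂` (first dousing, first zero, second
ignition, second dousing — the facts at each re-exported) extended by §139 at `T₂` and §140 at the
clock's second zero `tz₂`: `T₂ + 1.3939 ≤ tz₂ < T₂ + 3/2` with `b ≤ 0`, `c ≤ 3ρ²/K¹⁰`,
`a² ≥ 49/50` on `[T₂, tz₂]`; the THIRD ignition `r₂` with `c(r₂) = ρ²/K⁹`,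
`T₂ + 2.7878 < r₂ < tz₂ + 1.43` (lower side: part 45's cold window), `1.265ε ≤ b(r₂) ≤ 1.43ε`,
and `c ≤ ρ²/K⁹`, `b(t) ≥ 0.983ε(t - tz₂)`, `a² ≥ 0.983` on `[tz₂, r₂]`.
[cite: Tao2016AveragedNS, §5.5 Theorem 5.3, (5.5), (5.6), (b-eq), (c-eq), (energy-con)] -/
theorem knob_dud_third_ignition
    (hX : ∀ t, HasDerivAt X (RotorKnob.rotorCircuit K (K ^ 10) ε ρ (X t)) t)
    (h0 : X 0 = delayInit) (hC : ∀ t, HasDerivAt C (X t 2) t) (hK : 16 ≤ K) (hε : 0 < ε)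
    (hεK : ε ^ 2 ≤ 1 / (6 * K ^ 20)) (hρ : 0 < ρ) (hlo : 200 * ε / K ^ 20 ≤ ρ ^ 2)
    (hhi : K ^ 10 * ρ ^ 2 ≤ 2 * ε) (k : ℕ) (hk : ε = k * K ^ 10 * ρ ^ 2) :
    ∃ T tz r₁ T₂ tz₂ r₂ : ℝ,
      (√(2 - 24 * Real.log K / K ^ 10) ≤ T ∧ T ≤ √(2 + 2 / K ^ 10) + 242 / K ^ 9 ∧
        -(1414214 / 1000000 * ε) ≤ X T 1 ∧ X T 1 ≤ -(1414213 / 1000000 * ε) ∧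
        T + 1414213 / 1000000 ≤ tz ∧ tz ≤ T + 14242 / 10000 ∧ X tz 1 = 0) ∧
      (T + 28282 / 10000 < r₁ ∧ r₁ < T + 28542 / 10000 ∧ X r₁ 2 = ρ ^ 2 / K ^ 9 ∧
        1394 / 1000 * ε ≤ X r₁ 1 ∧ X r₁ 1 ≤ 144 / 100 * ε ∧ 993 / 1000 ≤ X r₁ 0 ^ 2 ∧
        |X r₁ 3| ≤ 2363 / 100000) ∧
      (r₁ < T₂ ∧ T₂ - r₁ ≤ 242 / K ^ 9 ∧ -(14401 / 10000 * ε) ≤ X T₂ 1 ∧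
        X T₂ 1 ≤ -(13939 / 10000 * ε) ∧ X T₂ 2 ≤ 2 * ρ ^ 2 / K ^ 10 ∧
        |(C T₂ - C r₁) / ρ ^ 2 - k * π| ≤ 7 / 100 ∧
        |X T₂ 3| ≤ 7 / 100 * |X r₁ 0| + |X r₁ 3| + 1 / 10 ^ 6 ∧ X T₂ 3 ^ 2 + X T₂ 4 ^ 2 ≤ 1 / 60 ∧
        59 / 60 - 1 / 10 ^ 5 ≤ X T₂ 0 ^ 2 ∧
        ∀ t ∈ Icc T₂ (T₂ + 27878 / 10000), X t 2 < ρ ^ 2 / K ^ 9) ∧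
      (T₂ + 13939 / 10000 ≤ tz₂ ∧ tz₂ < T₂ + 3 / 2 ∧ X tz₂ 1 = 0 ∧ ∀ t ∈ Icc T₂ tz₂,
        X t 1 ≤ 0 ∧ X t 2 ≤ 3 * ρ ^ 2 / K ^ 10 ∧ X T₂ 1 + 983 / 1000 * ε * (t - T₂) ≤ X t 1 ∧
        49 / 50 ≤ X t 0 ^ 2 ∧ X t 3 ^ 2 + X t 4 ^ 2 ≤ 1 / 60 + 4 / K ^ 10) ∧
      T₂ + 27878 / 10000 < r₂ ∧ r₂ < tz₂ + 143 / 100 ∧ X r₂ 2 = ρ ^ 2 / K ^ 9 ∧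
      (∀ t ∈ Icc tz₂ r₂, X t 2 ≤ ρ ^ 2 / K ^ 9 ∧ 983 / 1000 * ε * (t - tz₂) ≤ X t 1 ∧
        983 / 1000 ≤ X t 0 ^ 2) ∧ 1265 / 1000 * ε ≤ X r₂ 1 ∧ X r₂ 1 ≤ 143 / 100 * ε := by
  obtain ⟨T, tz, r₁, T₂, ⟨hr1, hr2, hsT, hτ, -, -, -, hcr₁, -, -, ha1, -⟩,
      ⟨hT1, hT2, hbTl, hbTu, htz1, htz2, hbtz, -, hTr1, hTr2, -⟩, hb1394, hb144, -, hbT₂l, hbT₂u,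
      hcold, hcT2, hpin7, hd2, hx, hpair, hcar⟩ :=
    knob_dud_second_misfire hX h0 hC hK hε hεK hρ hlo hhi k hk
  have hK0 : 0 < K := by linarith
  have h9 : (68719476736 : ℝ) ≤ K ^ 9 := by
    have := headline_pow_floor hK 9; norm_num at this; exact this
  have h10 : (1099511627776 : ℝ) ≤ K ^ 10 := by
    have := headline_pow_floor hK 10; norm_num at this; exact this
  -- the second dousing time lies in `[0, 5]`
  have hsq : √(2 + 2 / K ^ 10) ≤ 3 / 2 := by
    have h2 : 2 / K ^ 10 ≤ 2 / 1099511627776 :=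
      div_le_div_of_nonneg_left (by norm_num) (by norm_num) h10
    exact (Real.sqrt_le_left (by norm_num)).2 (by linarith only [h2])
  have h242 : (242 : ℝ) / K ^ 9 ≤ 242 / 68719476736 :=
    div_le_div_of_nonneg_left (by norm_num) (by norm_num) h9
  have hT₂0 : 0 ≤ T₂ := by
    linarith only [Real.sqrt_nonneg (2 - 24 * Real.log K / K ^ 10), hT1, hTr1, hsT]
  have hT₂5 : T₂ ≤ 5 := by linarith only [hTr2, hT2, hsq, h242, hτ]
  -- §139 at `T₂`: the clock's second zero `tz₂`
  obtain ⟨tz₂, htz₂T, htz₂H, hzlow, hbz₂, hP1⟩ := knob_late_rearm_clock hX h0 hK hε hεK hρ hhi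
    hT₂0 hT₂5 (by linarith only [hbT₂u, hε]) hbT₂l hcT2 hpair
  have htz₂l : T₂ + 13939 / 10000 ≤ tz₂ := by
    have h1 : ε * (13939 / 10000) ≤ ε * (tz₂ - T₂) := by linarith only [hzlow, hbT₂u]
    linarith only [le_of_mul_le_mul_left h1 hε]
  obtain ⟨-, hcz₂, -, -, hoz₂⟩ := hP1 tz₂ ⟨htz₂T, le_rfl⟩
  -- §140 at `tz₂`: the third ignition `r₂`; the cold window puts it beyond `T₂ + 2.7878`
  obtain ⟨r₂, hS1, hr₂Δ, hcr₂, hP2⟩ := knob_late_relight hX h0 hK hε hεK hρ hhi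
    (hT₂0.trans htz₂T) (by linarith only [htz₂H, hT₂5]) hbz₂ hcz₂ hoz₂
  have hr₂c : T₂ + 27878 / 10000 < r₂ := by
    by_contra h
    have h1 := hcold r₂ ⟨htz₂T.trans hS1.le, not_lt.mp h⟩
    rw [hcr₂] at h1
    exact lt_irrefl _ h1
  have hb₂ : 1265 / 1000 * ε ≤ X r₂ 1 := by
    have h1 := (hP2 r₂ ⟨hS1.le, le_rfl⟩).2.1
    nlinarith only [h1, hr₂c, htz₂H, hε]
  have hXf := hX
  rw [RotorKnob.rotorCircuit_eq_fiveGate] at hXf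
  have hb₂u : X r₂ 1 ≤ 143 / 100 * ε := by
    have h1 := clock_recovery hXf h0 hε.le (by positivity) hS1.le
    rw [hbz₂, zero_add] at h1
    nlinarith only [h1, hr₂Δ, hε]
  exact ⟨T, tz, r₁, T₂, tz₂, r₂, ⟨hT1, hT2, hbTl, hbTu, htz1, htz2, hbtz⟩,
    ⟨hTr1, hTr2, hcr₁, hb1394, hb144, ha1, hx⟩,
    ⟨hsT, hτ, hbT₂l, hbT₂u, hcT2, hpin7, hd2, hpair, hcar, hcold⟩,
    ⟨htz₂l, htz₂H, hbz₂, hP1⟩, hr₂c, hr₂Δ, hcr₂, hP2, hb₂, hb₂u⟩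

end Summit.NavierStokesRegularity.FluidComputer.GateBudget
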